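import Literature.NumberTheory.GaloisRepresentations.SUnitsRestrictedCohomologyDegreeTwoTorsionUpper
import HarnessLib

/-!
# The `p`-torsion of `H²(U, E_S)` has EXACTLY `p^{#S₀ − 1}` elements (`K` totally complex, `S ⊇ S_p` finite,
# `U = H/N_S ≤ G_{K,S}` open, `S₀` = the places of `F₀ = K̄^H` above `S`)
# (Neukirch–Schmidt–Wingberg (8.3.11) (ii)/(iii): `H²(G_S(F₀), E_S)(p) ≅ ker(⊕_{v ∈ S(F₀)} ℚ_p/ℤ_p →Σ ℚ_p/ℤ_p)`, as a COUNT)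

Topic `NumberTheory/GaloisRepresentations`; namespace `Literature.NumberTheory.GaloisRepresentations.SUnits.Layers`.
THEOREMS ONLY (no definition, no named fact, no `sorry`, no instance; D-0026).  Lane «TATE-EPC-TC» of cell `bsd-eis`
(crux `GoodLatticeBDPValue`, stmt-BirchSwinnertonDyer-19032; brick (F2-exact), colimit half, part 2 of 2; -w5 g7's S1
recipe consumes the counts `dim H²(G_{L,S}, E_S)[p] = #S_f(L) − 1`).  Sequel of
`SUnitsRestrictedCohomologyDegreeTwoTorsionUpper` (`≤`) and `SUnitsLayerInvariantsRealisation` (every sum-zero `p`-torsion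
family of invariants is realised; the invariants are inflation-stable).

* §2 LOWER BOUND `card_pi_erase_le_natCard_torsion`: an INJECTION `(S₀ ∖ {v₀} → (ℚ/ℤ)[p]) ↪ H²(U, E_S)[p]`: extend a
  family by `a_{v₀} := −Σ`, realise it above a cyclotomic layer with `p ∣ n_v` (`exists_cyclotomicLayer`,
  `exists_layer_realisation`), inflate to `H²(U, E_S)` (`inflG`, door-c4's `Φ`); the class is `p`-torsion
  (`nsmul_inflG_layerCohomologyIso_inv_eq_zero`), and two layer classes with the same inflation agree in a common deeper
  Galois layer (`exists_layer_stepG_eq_of_inflG_eq`, `exists_layerInf_eq_of_inflG_eq`: compositum + `exists_stepG_eq_stepG`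
  + `layerCohomologyIso_hom_stepG`), hence have the same invariants (`localInv_layerInf`); in particular
  **`localInv_eq_of_inflG_eq`**: the local invariants are a well-defined function on the classes of `H²(U, E_S)` (the
  input of the lane's equivariant readout `θ` in FILE D).
* §3 **`natCard_torsion_continuousCohomology_two_resRep_eq`:
  `Nat.card {y : H²(U, E_S) // p • y = 0} = p ^ (S₀.card - 1)`** (`natCard_torsion_eq_card_pi_erase` is the `v₀`-form).

HONEST FRAMING: a count, not the module isomorphism of (8.3.11); totally complex base only; no statement of a Summit, not
Tate's formula, not the crux is proved here; 0 cells / labels / tiers move.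

## References
* J. Neukirch, A. Schmidt, K. Wingberg, *Cohomology of Number Fields*, 2nd ed. (2008), VIII §3 (8.3.10)–(8.3.11), (1.5.1).
  [NeukirchSchmidtWingberg2008]
* J.-P. Serre, *Cohomologie galoisienne* (1994), I §2.2 Prop. 8. [SerreGaloisCohomology1997]
* J. W. S. Cassels, A. Fröhlich (eds.), *Algebraic Number Theory* (1967), Ch. VII (J. Tate) §7.3 Cor. 7.4, §11.2.
  [CasselsFrohlichANT1967]
-/

noncomputable section

open NumberField IsDedekindDomain Field Topology CategoryTheory
open Literature.NumberTheory.GaloisRepresentations.IdeleClassBar (GalLayer)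
open Literature.NumberTheory.GaloisRepresentations.LocalWeilDatum (galFixing galFixing_sup)
open Literature.NumberTheory.IwasawaTheory.Greenberg2006 (galoisGroupAbove)
open Literature.NumberTheory.GaloisRepresentations.OpenSubgroupLayer (algOfLE isScalarTower_algOfLE baseField
  exists_layerSubgroup_le layerSubgroup_anti)
open Literature.Algebra.Homology Literature.Algebra.Homology.DiscreteRep
open Literature.Algebra.Homology.DiscreteRep.LayerColimit (stepG inflG inflG_stepG stepG_stepG exists_stepG_eq_stepG)

namespace Literature.NumberTheory.GaloisRepresentations

namespace SUnits

namespace Layers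

variable {K : Type} [Field K] [NumberField K] {S : Set (HeightOneSpectrum (𝓞 K))}
  {H : Subgroup (absoluteGaloisGroup K)}

/-! ### §2. Lower bound: realising every family of invariants -/

/-- **A realised class is `p`-torsion in `H²(U, E_S)`**: for layers `E ≤ E'` of `K_S` above `F₀` and
`z ∈ H²(Gal(E/F₀), 𝒪_{E,S}ˣ)` with `Inf_{E→E'} (p • z) = 0`, the image of `z` in `H²(U, E_S)` (door-c4's `inflG` after the
layer isomorphism) is killed by `p`. [cite: SerreGaloisCohomology1997, I §2.2 Prop. 8] -/
theorem nsmul_inflG_layerCohomologyIso_inv_eq_zero (hHo : IsOpen (H : Set (absoluteGaloisGroup K)))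
    {E E' : GalLayer K} (hEE' : E ≤ E') (hF : baseField H ≤ E.1) (hS : ramificationSubgroup K S ≤ galFixing K E.1)
    (hS' : ramificationSubgroup K S ≤ galFixing K E'.1) (p : ℕ)
    (z : letI := algOfLE hF; groupCohomology (sUnitsRep K S ↥(baseField H) ↥E.1) 2)
    (hdead : haveI := E.isGalois; layerInf S hF (show E.1 ≤ E'.1 from hEE') 2 (p • z) = 0) :
    haveI := compactSpace_above K S H hHo
    p • inflG (OpenSubgroupLayer.layerSubgroup S hHo E hF hS) (resD K S H hHo) 2
      ((layerCohomologyIso hHo E hF hS 2).inv z) = 0 := by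
  haveI := compactSpace_above K S H hHo
  haveI := E.isGalois
  set u := (layerCohomologyIso hHo E hF hS 2).inv z with hu
  have hsq := layerCohomologyIso_hom_stepG hHo hEE' hF hS' 2 (p • u)
  have hz' : (layerCohomologyIso hHo E hF hS 2).hom (p • u) = p • z := by
    rw [map_nsmul, hu]
    exact congrArg _ ((layerCohomologyIso hHo E hF hS 2).inv_hom_id_apply z)
  rw [hz', hdead] at hsq
  have hst : stepG (OpenSubgroupLayer.layerSubgroup S hHo E hF hS)
      (OpenSubgroupLayer.layerSubgroup S hHo E' (hF.trans hEE') hS') (layerSubgroup_anti S hHo hEE' hF hS')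
      (resD K S H hHo) 2 (p • u) = 0 := by
    rw [← (layerCohomologyIso hHo E' (hF.trans hEE') hS' 2).hom_inv_id_apply (stepG _ _ _ _ 2 (p • u)), hsq, map_zero]
  rw [← map_nsmul, ← inflG_stepG _ _ (layerSubgroup_anti S hHo hEE' hF hS') (resD K S H hHo) 2 (p • u), hst,
    map_zero]

/-- **Two layer classes with the same image in `H²(U, E_S)` agree, as door-c4 classes, in a common deeper Galois
layer** `E₅ ⊇ E₁, E₂` of `K_S`: push both to the compositum `E₁E₂` (same `inflG`), kill the difference in an open normal
`V` (`exists_stepG_eq_stepG`), and pass to the compositum of `E₁E₂` with a Galois layer below `V`.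
[cite: SerreGaloisCohomology1997, I §2.2 Prop. 8] -/
theorem exists_layer_stepG_eq_of_inflG_eq (hHo : IsOpen (H : Set (absoluteGaloisGroup K)))
    (hNH : ramificationSubgroup K S ≤ H) {E₁ E₂ : GalLayer K} (hF₁ : baseField H ≤ E₁.1) (hF₂ : baseField H ≤ E₂.1)
    (hS₁ : ramificationSubgroup K S ≤ galFixing K E₁.1) (hS₂ : ramificationSubgroup K S ≤ galFixing K E₂.1)
    (c₁ : groupCohomology (layerRep hHo E₁ hF₁ hS₁) 2) (c₂ : groupCohomology (layerRep hHo E₂ hF₂ hS₂) 2)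
    (h : haveI := compactSpace_above K S H hHo
      inflG (OpenSubgroupLayer.layerSubgroup S hHo E₁ hF₁ hS₁) (resD K S H hHo) 2 c₁ =
        inflG (OpenSubgroupLayer.layerSubgroup S hHo E₂ hF₂ hS₂) (resD K S H hHo) 2 c₂) :
    ∃ (E₅ : GalLayer K) (h₁ : E₁ ≤ E₅) (h₂ : E₂ ≤ E₅) (hS₅ : ramificationSubgroup K S ≤ galFixing K E₅.1),
      stepG (OpenSubgroupLayer.layerSubgroup S hHo E₁ hF₁ hS₁)
          (OpenSubgroupLayer.layerSubgroup S hHo E₅ (hF₁.trans h₁) hS₅) (layerSubgroup_anti S hHo h₁ hF₁ hS₅)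
          (resD K S H hHo) 2 c₁ =
        stepG (OpenSubgroupLayer.layerSubgroup S hHo E₂ hF₂ hS₂)
          (OpenSubgroupLayer.layerSubgroup S hHo E₅ (hF₂.trans h₂) hS₅) (layerSubgroup_anti S hHo h₂ hF₂ hS₅)
          (resD K S H hHo) 2 c₂ := by
  haveI := compactSpace_above K S H hHo
  haveI := totallyDisconnectedSpace_above (S := S) (H := H)
  -- the compositum `E₃ = E₁E₂`
  let E₃ : GalLayer K := E₁.sup E₂
  have h₁₃ : E₁ ≤ E₃ := le_sup_left (a := E₁.1) (b := E₂.1)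
  have h₂₃ : E₂ ≤ E₃ := le_sup_right (a := E₁.1) (b := E₂.1)
  have hS₃ : ramificationSubgroup K S ≤ galFixing K E₃.1 := by
    change ramificationSubgroup K S ≤ galFixing K (E₁.1 ⊔ E₂.1)
    rw [galFixing_sup]
    exact le_inf hS₁ hS₂
  let W₁ := OpenSubgroupLayer.layerSubgroup S hHo E₁ hF₁ hS₁
  let W₂ := OpenSubgroupLayer.layerSubgroup S hHo E₂ hF₂ hS₂
  let W₃ := OpenSubgroupLayer.layerSubgroup S hHo E₃ (hF₁.trans h₁₃) hS₃
  have a₁ : (W₃ : Subgroup ↥(galoisGroupAbove S H)) ≤ W₁ := layerSubgroup_anti S hHo h₁₃ hF₁ hS₃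
  have a₂ : (W₃ : Subgroup ↥(galoisGroupAbove S H)) ≤ W₂ := layerSubgroup_anti S hHo h₂₃ hF₂ hS₃
  -- pushed to `V̄_{E₃}` the two classes still have the same `inflG`
  have h₃ : inflG W₃ (resD K S H hHo) 2 (stepG W₁ W₃ a₁ (resD K S H hHo) 2 c₁) =
      inflG W₃ (resD K S H hHo) 2 (stepG W₂ W₃ a₂ (resD K S H hHo) 2 c₂) := by
    rw [inflG_stepG W₁ W₃ a₁ (resD K S H hHo) 2 c₁, inflG_stepG W₂ W₃ a₂ (resD K S H hHo) 2 c₂]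
    exact h
  obtain ⟨V, hV₃, hV⟩ := exists_stepG_eq_stepG 2 (resD K S H hHo) W₃ _ _ h₃
  -- a Galois layer `E₄` with `V̄_{E₄} ≤ V`, and the compositum `E₅ = E₃E₄`
  obtain ⟨E₄, hF₄, hS₄, h₄V⟩ := exists_layerSubgroup_le S hHo hNH V
  let E₅ : GalLayer K := E₃.sup E₄
  have h₃₅ : E₃ ≤ E₅ := le_sup_left (a := E₃.1) (b := E₄.1)
  have h₄₅ : E₄ ≤ E₅ := le_sup_right (a := E₃.1) (b := E₄.1)
  have hS₅ : ramificationSubgroup K S ≤ galFixing K E₅.1 := by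
    change ramificationSubgroup K S ≤ galFixing K (E₃.1 ⊔ E₄.1)
    rw [galFixing_sup]
    exact le_inf hS₃ hS₄
  let W₅ := OpenSubgroupLayer.layerSubgroup S hHo E₅ (hF₄.trans h₄₅) hS₅
  have a₄₅ : (W₅ : Subgroup ↥(galoisGroupAbove S H)) ≤ OpenSubgroupLayer.layerSubgroup S hHo E₄ hF₄ hS₄ :=
    layerSubgroup_anti S hHo h₄₅ hF₄ hS₅
  have h₅V : (W₅ : Subgroup ↥(galoisGroupAbove S H)) ≤ V := a₄₅.trans h₄V
  -- at `V̄_{E₅}` the pushed classes agree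
  have hV₅ : stepG W₁ W₅ ((h₅V.trans hV₃).trans a₁) (resD K S H hHo) 2 c₁ =
      stepG W₂ W₅ ((h₅V.trans hV₃).trans a₂) (resD K S H hHo) 2 c₂ := by
    rw [← stepG_stepG W₁ V (hV₃.trans a₁) (resD K S H hHo) 2 W₅ h₅V c₁,
      ← stepG_stepG W₂ V (hV₃.trans a₂) (resD K S H hHo) 2 W₅ h₅V c₂,
      ← stepG_stepG W₁ W₃ a₁ (resD K S H hHo) 2 V hV₃ c₁, ← stepG_stepG W₂ W₃ a₂ (resD K S H hHo) 2 V hV₃ c₂, hV]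
  exact ⟨E₅, h₁₃.trans h₃₅, h₂₃.trans h₃₅, hS₅, hV₅⟩

/-- **Two realised classes with the same image in `H²(U, E_S)` agree after inflation to a common deeper layer**:
if `inflG (iso_{E₁}⁻¹ z₁) = inflG (iso_{E₂}⁻¹ z₂)`, then `Inf_{E₁→E₅} z₁ = Inf_{E₂→E₅} z₂` in some finite Galois layer
`E₅ ⊇ E₁, E₂` of `K_S` (`exists_layer_stepG_eq_of_inflG_eq` read through `layerCohomologyIso_hom_stepG`).
[cite: SerreGaloisCohomology1997, I §2.2 Prop. 8] -/
theorem exists_layerInf_eq_of_inflG_eq (hHo : IsOpen (H : Set (absoluteGaloisGroup K)))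
    (hNH : ramificationSubgroup K S ≤ H) {E₁ E₂ : GalLayer K} (hF₁ : baseField H ≤ E₁.1) (hF₂ : baseField H ≤ E₂.1)
    (hS₁ : ramificationSubgroup K S ≤ galFixing K E₁.1) (hS₂ : ramificationSubgroup K S ≤ galFixing K E₂.1)
    (z₁ : letI := algOfLE hF₁; groupCohomology (sUnitsRep K S ↥(baseField H) ↥E₁.1) 2)
    (z₂ : letI := algOfLE hF₂; groupCohomology (sUnitsRep K S ↥(baseField H) ↥E₂.1) 2)
    (h : haveI := compactSpace_above K S H hHo
      inflG (OpenSubgroupLayer.layerSubgroup S hHo E₁ hF₁ hS₁) (resD K S H hHo) 2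
          ((layerCohomologyIso hHo E₁ hF₁ hS₁ 2).inv z₁) =
        inflG (OpenSubgroupLayer.layerSubgroup S hHo E₂ hF₂ hS₂) (resD K S H hHo) 2
          ((layerCohomologyIso hHo E₂ hF₂ hS₂ 2).inv z₂)) :
    ∃ (E₅ : GalLayer K) (h₁ : E₁ ≤ E₅) (h₂ : E₂ ≤ E₅) (_ : ramificationSubgroup K S ≤ galFixing K E₅.1),
      (haveI := E₁.isGalois; layerInf S hF₁ (show E₁.1 ≤ E₅.1 from h₁) 2 z₁) =
        (haveI := E₂.isGalois; layerInf S hF₂ (show E₂.1 ≤ E₅.1 from h₂) 2 z₂) := by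
  haveI := compactSpace_above K S H hHo
  haveI := E₁.isGalois
  haveI := E₂.isGalois
  obtain ⟨E₅, h₁, h₂, hS₅, h₅⟩ := exists_layer_stepG_eq_of_inflG_eq hHo hNH hF₁ hF₂ hS₁ hS₂ _ _ h
  refine ⟨E₅, h₁, h₂, hS₅, ?_⟩
  have e₁ := layerCohomologyIso_hom_stepG hHo h₁ hF₁ hS₅ 2 ((layerCohomologyIso hHo E₁ hF₁ hS₁ 2).inv z₁)
  have e₂ := layerCohomologyIso_hom_stepG hHo h₂ hF₂ hS₅ 2 ((layerCohomologyIso hHo E₂ hF₂ hS₂ 2).inv z₂)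
  rw [(layerCohomologyIso hHo E₁ hF₁ hS₁ 2).inv_hom_id_apply z₁] at e₁
  rw [(layerCohomologyIso hHo E₂ hF₂ hS₂ 2).inv_hom_id_apply z₂] at e₂
  rw [← e₁, ← e₂]
  exact congrArg _ h₅

/-- **Equal images in `H²(U, E_S)` ⟹ equal invariants**: if two layer classes `z₁ ∈ H²(Gal(E₁/F₀), 𝒪_{E₁,S}ˣ)`,
`z₂ ∈ H²(Gal(E₂/F₀), 𝒪_{E₂,S}ˣ)` have the same image in `H²(U, E_S)` (door-c4's `inflG` after the layer isomorphisms), then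
`inv_v(ι z₁) = inv_v(ι z₂)` for every finite place `v` of `F₀` — the local invariants are a well-defined function on the
classes of `H²(U, E_S)` coming from the layers (all of them, (A2-α)).  (`exists_layerInf_eq_of_inflG_eq` +
`localInv_layerInf`.) [cite: NeukirchSchmidtWingberg2008, VIII §3 (8.3.11)] [cite: SerreGaloisCohomology1997, I §2.2 Prop. 8] -/
theorem localInv_eq_of_inflG_eq (hHo : IsOpen (H : Set (absoluteGaloisGroup K))) (hNH : ramificationSubgroup K S ≤ H)
    [NumberField ↥(baseField H)] (S₀ : Finset (HeightOneSpectrum (𝓞 ↥(baseField H))))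
    (hSF : ∀ u : HeightOneSpectrum (𝓞 ↥(baseField H)), u ∈ S₀ ↔ u.under (𝓞 K) ∈ S)
    {E₁ E₂ : GalLayer K} (hF₁ : baseField H ≤ E₁.1) (hF₂ : baseField H ≤ E₂.1)
    (hS₁ : ramificationSubgroup K S ≤ galFixing K E₁.1) (hS₂ : ramificationSubgroup K S ≤ galFixing K E₂.1)
    (z₁ : letI := algOfLE hF₁; groupCohomology (sUnitsRep K S ↥(baseField H) ↥E₁.1) 2)
    (z₂ : letI := algOfLE hF₂; groupCohomology (sUnitsRep K S ↥(baseField H) ↥E₂.1) 2)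
    (h : haveI := compactSpace_above K S H hHo
      inflG (OpenSubgroupLayer.layerSubgroup S hHo E₁ hF₁ hS₁) (resD K S H hHo) 2
          ((layerCohomologyIso hHo E₁ hF₁ hS₁ 2).inv z₁) =
        inflG (OpenSubgroupLayer.layerSubgroup S hHo E₂ hF₂ hS₂) (resD K S H hHo) 2
          ((layerCohomologyIso hHo E₂ hF₂ hS₂ 2).inv z₂))
    (v : HeightOneSpectrum (𝓞 ↥(baseField H))) :
    (letI := algOfLE hF₁
     haveI := isScalarTower_algOfLE (K := K) hF₁
     haveI := E₁.isGalois
     haveI : NumberField ↥E₁.1 := E₁.numberField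
     haveI : IsGalois ↥(baseField H) ↥E₁.1 := IsGalois.tower_top_of_isGalois K ↥(baseField H) ↥E₁.1
     IdeleCohomology.localInv ↥E₁.1 v
       (groupCohomology.map (MonoidHom.id _) (IdeleCohomology.ideleSRepHom S₀) 2
         (groupCohomology.map (MonoidHom.id _) (IdeleCohomology.sUnitsToIdeleS (K := K) (E := ↥E₁.1) S S₀ hSF) 2 z₁))) =
      (letI := algOfLE hF₂
       haveI := isScalarTower_algOfLE (K := K) hF₂
       haveI := E₂.isGalois
       haveI : NumberField ↥E₂.1 := E₂.numberField
       haveI : IsGalois ↥(baseField H) ↥E₂.1 := IsGalois.tower_top_of_isGalois K ↥(baseField H) ↥E₂.1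
       IdeleCohomology.localInv ↥E₂.1 v
         (groupCohomology.map (MonoidHom.id _) (IdeleCohomology.ideleSRepHom S₀) 2
           (groupCohomology.map (MonoidHom.id _) (IdeleCohomology.sUnitsToIdeleS (K := K) (E := ↥E₂.1) S S₀ hSF) 2 z₂))) := by
  haveI := E₁.finiteDimensional
  haveI := E₂.finiteDimensional
  haveI := E₁.isGalois
  haveI := E₂.isGalois
  obtain ⟨E₅, h₁, h₂, hS₅, h₅⟩ := exists_layerInf_eq_of_inflG_eq hHo hNH hF₁ hF₂ hS₁ hS₂ z₁ z₂ h
  haveI := E₅.finiteDimensional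
  haveI := E₅.isGalois
  rw [← localInv_layerInf S hF₁ (show E₁.1 ≤ E₅.1 from h₁) S₀ hSF z₁ v,
    ← localInv_layerInf S hF₂ (show E₂.1 ≤ E₅.1 from h₂) S₀ hSF z₂ v, h₅]

open scoped Classical in
/-- **LOWER BOUND.**  `#(S₀ ∖ {v₀} → (ℚ/ℤ)[p]) ≤ #H²(U, E_S)[p]` (`K` totally complex, `S ⊇ S_p` finite, `v₀ ∈ S₀`):
the map «family ↦ realised class» is an injection.  A family `g` on `S₀ ∖ {v₀}` is completed by `a_{v₀} := −Σ g`,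
realised in a layer above a cyclotomic layer with `p ∣ n_v` (`exists_layer_realisation`), inflated to `H²(U, E_S)`; the
inflated class is `p`-torsion (`nsmul_inflG_layerCohomologyIso_inv_eq_zero`), and two families with the same class have the
same invariants (`exists_layerInf_eq_of_inflG_eq`, `localInv_layerInf`).
[cite: NeukirchSchmidtWingberg2008, VIII §3 (8.3.11) (ii)/(iii)] [cite: SerreGaloisCohomology1997, I §2.2 Prop. 8] -/
theorem card_pi_erase_le_natCard_torsion [IsTotallyComplex K] (hHo : IsOpen (H : Set (absoluteGaloisGroup K)))
    (hNH : ramificationSubgroup K S ≤ H) (hfin : S.Finite) [NumberField ↥(baseField H)]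
    (S₀ : Finset (HeightOneSpectrum (𝓞 ↥(baseField H))))
    (hSF : ∀ u : HeightOneSpectrum (𝓞 ↥(baseField H)), u ∈ S₀ ↔ u.under (𝓞 K) ∈ S)
    {v₀ : HeightOneSpectrum (𝓞 ↥(baseField H))} (hv₀ : v₀ ∈ S₀) (p : ℕ) [Fact p.Prime]
    (hSp : ∀ v : HeightOneSpectrum (𝓞 K), ((p : ℕ) : 𝓞 K) ∈ v.asIdeal → v ∈ S) :
    Nat.card (↥(S₀.erase v₀) → {a : AddCircle (1 : ℚ) // p • a = 0}) ≤
      Nat.card {y : continuousCohomology 2 (resRep K S H).toTopRep // p • y = 0} := by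
  have hp : p.Prime := Fact.out
  haveI := compactSpace_above K S H hHo
  haveI := totallyDisconnectedSpace_above (S := S) (H := H)
  haveI : Finite {y : continuousCohomology 2 (resRep K S H).toTopRep // p • y = 0} :=
    (finite_torsion_continuousCohomology_two_resRep hHo hNH hfin hp.pos).to_subtype
  -- a base layer `E₀ ⊇ F₀` and a cyclotomic layer `E₁ ⊇ E₀` with `p ∣ n_v(E₁)` on `S₀`
  obtain ⟨E₀, hF₀, hS₀, -⟩ := exists_layerSubgroup_le S hHo hNH (⟨⊤, by simp⟩ : OpenNormalSubgroup ↥(galoisGroupAbove S H))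
  haveI := E₀.finiteDimensional
  haveI := E₀.isGalois
  haveI : NumberField ↥E₀.1 := E₀.numberField
  obtain ⟨E₁, h₀₁, hfd₁, hgal₁, hS₁, hdeg⟩ := exists_cyclotomicLayer S p hSp hF₀ hS₀ S₀ 1
  haveI := hfd₁
  haveI := hgal₁
  have hF₁ : baseField H ≤ E₁ := hF₀.trans h₀₁
  letI := algOfLE hF₀
  letI := algOfLE hF₁
  haveI : NumberField ↥E₁ := NumberField.of_module_finite K _
  have hdeg₁ : ∀ v ∈ S₀, p ∣ IdeleCohomology.localDegree ↥E₁ v := fun v hv => by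
    obtain ⟨m, hm⟩ := hdeg v hv
    exact ⟨IdeleCohomology.localDegree (↥E₀.1) v * m, by rw [hm, pow_one, mul_assoc]⟩
  -- the families: extend `g` on `S₀ ∖ {v₀}` by `−Σ g` at `v₀`
  let T := {a : AddCircle (1 : ℚ) // p • a = 0}
  let A : (↥(S₀.erase v₀) → T) → HeightOneSpectrum (𝓞 ↥(baseField H)) → AddCircle (1 : ℚ) := fun g v =>
    if hv : v ∈ S₀.erase v₀ then ((g ⟨v, hv⟩ : T) : AddCircle (1 : ℚ))
    else if v = v₀ then -∑ w, ((g w : T) : AddCircle (1 : ℚ)) else 0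
  have hA1 : ∀ g (w : ↥(S₀.erase v₀)), A g w.1 = ((g w : T) : AddCircle (1 : ℚ)) := fun g w => by
    simp only [A, dif_pos w.2]
  have hA0 : ∀ g, A g v₀ = -∑ w, ((g w : T) : AddCircle (1 : ℚ)) := fun g => by
    have h : A g v₀ = (if v₀ = v₀ then -∑ w, ((g w : T) : AddCircle (1 : ℚ)) else 0) :=
      dif_neg (Finset.notMem_erase v₀ S₀)
    rw [h, if_pos rfl]
  have hap : ∀ g, ∀ v ∈ S₀, p • A g v = 0 := fun g v hv => by
    by_cases hvv : v = v₀
    · rw [hvv, hA0, smul_neg, Finset.smul_sum, neg_eq_zero]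
      exact Finset.sum_eq_zero fun w _ => (g w).2
    · rw [hA1 g ⟨v, Finset.mem_erase.2 ⟨hvv, hv⟩⟩]
      exact (g _).2
  have hsumA : ∀ g, ∑ v ∈ S₀, A g v = 0 := fun g => by
    rw [← Finset.add_sum_erase S₀ (A g) hv₀, hA0, ← Finset.sum_coe_sort (S₀.erase v₀),
      Finset.sum_congr rfl fun w _ => hA1 g w, neg_add_cancel]
  -- realise every family
  have hreal := fun g : ↥(S₀.erase v₀) → T =>
    exists_layer_realisation S hF₁ hS₁ S₀ hSF p hdeg₁ (A g) (hap g) (hsumA g)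
  choose E' hfd' hgal' hEE' hS' z hz E'' hfd'' hgal'' hE'E'' hS'' hdead using hreal
  -- the layers as `GalLayer`s and the realised classes in `H²(U, E_S)`
  let L' : (↥(S₀.erase v₀) → T) → GalLayer K := fun g => ⟨E' g, hfd' g, hgal' g⟩
  let L'' : (↥(S₀.erase v₀) → T) → GalLayer K := fun g => ⟨E'' g, hfd'' g, hgal'' g⟩
  have hFL' : ∀ g, baseField H ≤ (L' g).1 := fun g => hF₁.trans (hEE' g)
  have hLL : ∀ g, L' g ≤ L'' g := fun g => hE'E'' g
  have hy : ∀ g, p • inflG (OpenSubgroupLayer.layerSubgroup S hHo (L' g) (hFL' g) (hS' g)) (resD K S H hHo) 2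
      ((layerCohomologyIso hHo (L' g) (hFL' g) (hS' g) 2).inv (z g)) = 0 := fun g =>
    nsmul_inflG_layerCohomologyIso_inv_eq_zero hHo (hLL g) (hFL' g) (hS' g) (hS'' g) p (z g) (hdead g)
  -- transport to Mathlib's continuous cohomology
  let Φ : CategoryTheory.Abelian.Ext (triv (Γ := ↥(galoisGroupAbove S H)) ℤ) (resD K S H hHo) 2 ≃+
      (continuousCohomology 2 (resRep K S H).toTopRep : TopModuleCat ℤ) :=
    extTrivAddEquivContinuousCohomology (resRep K S H).toTopRep (isDiscrete_resRep K S H) 2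
  let Y : (↥(S₀.erase v₀) → T) → {y : continuousCohomology 2 (resRep K S H).toTopRep // p • y = 0} := fun g =>
    ⟨Φ (inflG (OpenSubgroupLayer.layerSubgroup S hHo (L' g) (hFL' g) (hS' g)) (resD K S H hHo) 2
      ((layerCohomologyIso hHo (L' g) (hFL' g) (hS' g) 2).inv (z g))), by rw [← map_nsmul, hy g, map_zero]⟩
  refine Nat.card_le_card_of_injective Y fun g g' hgg' => ?_
  -- two families with the same class agree in a common layer `E₅`, hence have the same invariants
  have hyy := Φ.injective (congrArg Subtype.val hgg')
  obtain ⟨E₅, h₁, h₂, hS₅, h₅⟩ := exists_layerInf_eq_of_inflG_eq hHo hNH (hFL' g) (hFL' g') (hS' g) (hS' g')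
    (z g) (z g') hyy
  haveI := E₅.finiteDimensional
  haveI := E₅.isGalois
  funext w
  apply Subtype.ext
  have hw : w.1 ∈ S₀ := Finset.mem_of_mem_erase w.2
  rw [← hA1 g w, ← hA1 g' w, ← hz g w.1 hw, ← hz g' w.1 hw,
    ← localInv_layerInf S (hFL' g) (show (L' g).1 ≤ E₅.1 from h₁) S₀ hSF (z g) w.1,
    ← localInv_layerInf S (hFL' g') (show (L' g').1 ≤ E₅.1 from h₂) S₀ hSF (z g') w.1, h₅]

/-! ### §3. The count -/

open scoped Classical in
/-- **`#H²(U, E_S)[p] = #(S₀ ∖ {v₀} → (ℚ/ℤ)[p])`** (`K` totally complex, `S ⊇ S_p` finite, `v₀ ∈ S₀`).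
[cite: NeukirchSchmidtWingberg2008, VIII §3 (8.3.11) (ii)/(iii)] -/
theorem natCard_torsion_eq_card_pi_erase [IsTotallyComplex K] (hHo : IsOpen (H : Set (absoluteGaloisGroup K)))
    (hNH : ramificationSubgroup K S ≤ H) (hfin : S.Finite) [NumberField ↥(baseField H)]
    (S₀ : Finset (HeightOneSpectrum (𝓞 ↥(baseField H))))
    (hSF : ∀ u : HeightOneSpectrum (𝓞 ↥(baseField H)), u ∈ S₀ ↔ u.under (𝓞 K) ∈ S)
    {v₀ : HeightOneSpectrum (𝓞 ↥(baseField H))} (hv₀ : v₀ ∈ S₀) (p : ℕ) [Fact p.Prime]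
    (hSp : ∀ v : HeightOneSpectrum (𝓞 K), ((p : ℕ) : 𝓞 K) ∈ v.asIdeal → v ∈ S) :
    Nat.card {y : continuousCohomology 2 (resRep K S H).toTopRep // p • y = 0} =
      Nat.card (↥(S₀.erase v₀) → {a : AddCircle (1 : ℚ) // p • a = 0}) := by
  have hp : 0 < p := (Fact.out : p.Prime).pos
  refine le_antisymm ?_ (card_pi_erase_le_natCard_torsion hHo hNH hfin S₀ hSF hv₀ p hSp)
  have hfin' := finite_torsion_continuousCohomology_two_resRep hHo hNH hfin hp
  haveI : Fintype {y : continuousCohomology 2 (resRep K S H).toTopRep // p • y = 0} := hfin'.fintype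
  rw [Nat.card_eq_fintype_card, ← Finset.card_univ,
    ← Finset.card_map (Function.Embedding.subtype fun y : continuousCohomology 2 (resRep K S H).toTopRep => p • y = 0)]
  refine finsetCard_torsion_le_card_pi_erase hHo hNH S₀ hSF hv₀ hp _ fun x hx => ?_
  obtain ⟨y, -, rfl⟩ := Finset.mem_map.1 hx
  exact y.2

/-- **THE COUNT: `#H²(U, E_S)[p] = p^{#S₀ − 1}`** (`K` totally complex, `S ⊇ S_p` finite, `U = H/N_S ≤ G_{K,S}` open,
`S₀ ≠ ∅` the places of `F₀ = K̄^H` above `S`) — NSW (8.3.11) (ii)/(iii) as a count: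
`H²(G_S(F₀), E_S)(p) ≅ ker(⊕_{v ∈ S₀} ℚ_p/ℤ_p → ℚ_p/ℤ_p)`. [cite: NeukirchSchmidtWingberg2008, VIII §3 (8.3.11) (ii)/(iii)]
[cite: CasselsFrohlichANT1967, Ch. VII §11.2] -/
theorem natCard_torsion_continuousCohomology_two_resRep_eq [IsTotallyComplex K]
    (hHo : IsOpen (H : Set (absoluteGaloisGroup K))) (hNH : ramificationSubgroup K S ≤ H) (hfin : S.Finite)
    [NumberField ↥(baseField H)] (S₀ : Finset (HeightOneSpectrum (𝓞 ↥(baseField H))))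
    (hSF : ∀ u : HeightOneSpectrum (𝓞 ↥(baseField H)), u ∈ S₀ ↔ u.under (𝓞 K) ∈ S) (hS₀ : S₀.Nonempty)
    (p : ℕ) [Fact p.Prime] (hSp : ∀ v : HeightOneSpectrum (𝓞 K), ((p : ℕ) : 𝓞 K) ∈ v.asIdeal → v ∈ S) :
    Nat.card {y : continuousCohomology 2 (resRep K S H).toTopRep // p • y = 0} = p ^ (S₀.card - 1) := by
  classical
  obtain ⟨v₀, hv₀⟩ := hS₀
  rw [natCard_torsion_eq_card_pi_erase hHo hNH hfin S₀ hSF hv₀ p hSp,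
    natCard_pi_addCircle_torsion_eq (S₀.erase v₀) (Fact.out : p.Prime), Finset.card_erase_of_mem hv₀]

end Layers

end SUnits

end Literature.NumberTheory.GaloisRepresentations

end
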